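import Literature.Analysis.FluidPDE.SereginZajaczkowski2007SwirlEquation
import Literature.Analysis.FluidPDE.SereginZajaczkowski2007SwirlWeak
import Literature.Analysis.FluidPDE.NSSliceTimePairing
import HarnessLib

/-!
# Seregin–Zajaczkowski 2007, (4.15): discharge of `SwirlEquation`

G. Seregin, W. Zajaczkowski, *A sufficient condition of regularity for axially symmetric
solutions to the Navier–Stokes equations*, SIAM J. Math. Anal. 39 (2007) 669–685 =
arXiv:math/0702720, §4, proof of Lemma 4.3: "We know that `V_φ` satisfies the equation (4.15)".
This file proves the named fact `SereginZajaczkowski2007.SwirlEquation`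
(`SereginZajaczkowski2007SwirlEquation.lean`): for the hypothesis class of Prop. 4.1 on
`Q̃ = 𝒞(1/4, 3; 2) × ]-2², 0[`, at every point `x` of the shell and all `-2² < s ≤ t < 0`,
`α(t, x) - α(s, x) = ∫ₛᵗ (Δα - Dα[V] - (2/ϱ)∂_ϱα)(r, x) dr`, `α = x₀V₁ - x₁V₀ = ϱV_φ`
(`SwirlEquation_holds`).

Proof. The sibling file `SereginZajaczkowski2007SwirlWeak.lean` proves (4.15) in the sense of
distributions on `Q̃`: `∫∫ (α ∂ₜφ + G φ) = 0` for all `φ ∈ C_c^∞(Q̃)`, with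
`G = Δα - Dα[V] - (2/ϱ)∂_ϱα` continuous on `Q̃` (`continuousOn_swirlOperator`). The passage from
the distributional identity to the pointwise, time-integrated one
(`sub_eq_intervalIntegral_of_forall_test`) is: test with `φ = η(t)χ(x)`, Fubini, the fundamental
lemma of the calculus of variations in `x` (Mathlib's
`IsOpen.ae_eq_zero_of_integral_contDiff_smul_eq_zero`) and continuity in `x` of the parametric
time integral (`continuousOn_integral_slice`) give `∫ (η' α(·,x) + η G(·,x)) dt = 0` for every
`x` and `η`; the tree's du Bois-Reymond lemma with a source term
(`exists_ae_eq_const_add_primitive`) and continuity in `t` give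
`α(t,x) = c + ∫ G(·,x)` on every compact subinterval, whence the claim.

## References

* G. Seregin, W. Zajaczkowski, SIAM J. Math. Anal. 39 (2007) 669–685, arXiv:math/0702720, §4
  proof of Lemma 4.3, (4.15) and "`α = V_φ ϱ`". [`SereginZajaczkowski2007`]
* H. Brezis, *Functional Analysis, Sobolev Spaces and PDE* (Springer 2011), Lemma 8.1,
  Cor. 8.10 (du Bois-Reymond).
-/

noncomputable section

open MeasureTheory Set Function Filter Topology TopologicalSpace Metric WithLp
open scoped NNReal ENNReal ContDiff InnerProductSpace RealInnerProductSpace Laplacian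

namespace Literature.Analysis.FluidPDE

namespace SereginZajaczkowski2007

open SereginSverak2009

/-! ### Continuity of parametric time integrals -/

section Parametric

variable {I : Set ℝ} {U : Set (EuclideanSpace ℝ (Fin 3))} {H : ℝ × (EuclideanSpace ℝ (Fin 3)) → ℝ} {K : Set ℝ}

/-- A function continuous on `I × U` (`I` open) which vanishes for times outside a closed
`K ⊆ I` has continuous time slices `t ↦ H(t, x)`, `x ∈ U`. [folklore] -/
theorem continuous_slice_time (hI : IsOpen I) (hU : IsOpen U) (hH : ContinuousOn H (I ×ˢ U))
    (hK : IsClosed K) (hKI : K ⊆ I) (h0 : ∀ t, t ∉ K → ∀ x, H (t, x) = 0) {x : (EuclideanSpace ℝ (Fin 3))} (hx : x ∈ U) :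
    Continuous fun t => H (t, x) := by
  rw [continuous_iff_continuousAt]
  intro t
  by_cases ht : t ∈ I
  · have hc : ContinuousAt H (t, x) := hH.continuousAt ((hI.prod hU).mem_nhds ⟨ht, hx⟩)
    exact ContinuousAt.comp (f := fun s : ℝ => ((s, x) : ℝ × (EuclideanSpace ℝ (Fin 3)))) hc
      (continuous_id.prodMk continuous_const).continuousAt
  · have htK : t ∉ K := fun h => ht (hKI h)
    have hev : (fun s => H (s, x)) =ᶠ[𝓝 t] fun _ => 0 := by
      filter_upwards [hK.isOpen_compl.mem_nhds htK] with s hs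
      exact h0 s hs x
    exact continuousAt_const.congr hev.symm

/-- **Continuity of a parametric time integral.** If `H` is continuous on `I × U` (`I`, `U` open)
and vanishes for times outside a compact `K ⊆ I`, then `x ↦ ∫ H(t, x) dt` is continuous on `U`
(dominated convergence with a constant bound on `K × B̄(x₀, δ)`). [folklore] -/
theorem continuousOn_integral_slice (hI : IsOpen I) (hU : IsOpen U) (hH : ContinuousOn H (I ×ˢ U))
    (hK : IsCompact K) (hKI : K ⊆ I) (h0 : ∀ t, t ∉ K → ∀ x, H (t, x) = 0) :
    ContinuousOn (fun x => ∫ t, H (t, x)) U := by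
  intro x₀ hx₀
  refine ContinuousAt.continuousWithinAt ?_
  obtain ⟨δ, hδ, hball⟩ := Metric.mem_nhds_iff.1 (hU.mem_nhds hx₀)
  have hcb : closedBall x₀ (δ / 2) ⊆ U := fun y hy =>
    hball (mem_ball.2 (lt_of_le_of_lt (mem_closedBall.1 hy) (by linarith)))
  obtain ⟨C, hC⟩ := (hK.prod (isCompact_closedBall x₀ (δ / 2))).exists_bound_of_continuousOn
    (hH.mono (prod_mono hKI hcb))
  have hnhds : closedBall x₀ (δ / 2) ∈ 𝓝 x₀ := closedBall_mem_nhds x₀ (by positivity)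
  refine continuousAt_of_dominated (bound := K.indicator fun _ => C) ?_ ?_ ?_ ?_
  · filter_upwards [hnhds] with x hx
    exact (continuous_slice_time hI hU hH hK.isClosed hKI h0 (hcb hx)).aestronglyMeasurable
  · filter_upwards [hnhds] with x hx
    refine Eventually.of_forall fun t => ?_
    by_cases ht : t ∈ K
    · rw [indicator_of_mem ht]
      exact hC (t, x) ⟨ht, hx⟩
    · rw [indicator_of_notMem ht, h0 t ht x, norm_zero]
  · exact (integrableOn_const (hK.measure_lt_top.ne)).integrable_indicator hK.measurableSet
  · refine Eventually.of_forall fun t => ?_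
    by_cases ht : t ∈ I
    · have hc : ContinuousAt H (t, x₀) := hH.continuousAt ((hI.prod hU).mem_nhds ⟨ht, hx₀⟩)
      exact ContinuousAt.comp (f := fun y : (EuclideanSpace ℝ (Fin 3)) => ((t, y) : ℝ × (EuclideanSpace ℝ (Fin 3)))) hc
        (continuous_const.prodMk continuous_id).continuousAt
    · have htK : t ∉ K := fun h => ht (hKI h)
      have heq : (fun x => H (t, x)) = fun _ => 0 := funext fun x => h0 t htK x
      rw [heq]
      exact continuousAt_const

end Parametric

/-! ### From the distributional identity to the pointwise time-integrated one -/

section Localisation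

variable {lo hi : ℝ} {U : Set (EuclideanSpace ℝ (Fin 3))} {Q : Opens (ℝ × (EuclideanSpace ℝ (Fin 3)))} {a G : ℝ × (EuclideanSpace ℝ (Fin 3)) → ℝ}

/-- Product test functions `η(t) χ(x)` on `]lo, hi[ × U` are space–time test functions there.
[folklore] -/
theorem isSpaceTimeTestOn_mul (hQ : (Q : Set (ℝ × (EuclideanSpace ℝ (Fin 3)))) = Ioo lo hi ×ˢ U)
    {η : ℝ → ℝ} (hη : ContDiff ℝ ∞ η) (hηc : HasCompactSupport η) (hηI : tsupport η ⊆ Ioo lo hi)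
    {χ : (EuclideanSpace ℝ (Fin 3)) → ℝ} (hχ : ContDiff ℝ ∞ χ) (hχc : HasCompactSupport χ) (hχU : tsupport χ ⊆ U) :
    IsSpaceTimeTestOn Q (fun t x => η t * χ x) := by
  have heq : uncurry (fun t x => η t * χ x) = fun z : ℝ × (EuclideanSpace ℝ (Fin 3)) => η z.1 * χ z.2 := rfl
  refine ⟨?_, ?_, ?_⟩
  · rw [heq]
    exact (hη.comp contDiff_fst).mul (hχ.comp contDiff_snd)
  · rw [heq]
    refine HasCompactSupport.intro (hηc.prod hχc) fun z hz => ?_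
    rw [mem_prod, not_and_or] at hz
    rcases hz with h | h
    · rw [image_eq_zero_of_notMem_tsupport h, zero_mul]
    · rw [image_eq_zero_of_notMem_tsupport h, mul_zero]
  · rw [heq, hQ]
    refine closure_minimal (fun z hz => ?_) ((isClosed_tsupport η).prod (isClosed_tsupport χ))
      |>.trans (prod_mono hηI hχU)
    rw [mem_support, mul_ne_zero_iff] at hz
    exact ⟨subset_tsupport _ hz.1, subset_tsupport _ hz.2⟩

/-- **Slicing the distributional identity.** If `a`, `G` are continuous on `]lo, hi[ × U` and
`∫∫ (a ∂ₜφ + G φ) = 0` for all space–time test functions `φ` on `]lo, hi[ × U`, then for every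
`x ∈ U` and every test function `η` on `]lo, hi[`, `∫ (η' a(·, x) + η G(·, x)) dt = 0`
(test with `η(t)χ(x)`, Fubini, the fundamental lemma of the calculus of variations in `x`, and
continuity in `x`). [folklore] -/
theorem integral_deriv_mul_add_mul_eq_zero_of_forall_test (hU : IsOpen U)
    (hQ : (Q : Set (ℝ × (EuclideanSpace ℝ (Fin 3)))) = Ioo lo hi ×ˢ U) (ha : ContinuousOn a (Q : Set (ℝ × (EuclideanSpace ℝ (Fin 3)))))
    (hG : ContinuousOn G (Q : Set (ℝ × (EuclideanSpace ℝ (Fin 3)))))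
    (h : ∀ φ : ℝ → (EuclideanSpace ℝ (Fin 3)) → ℝ, IsSpaceTimeTestOn Q φ →
      ∫ z : ℝ × (EuclideanSpace ℝ (Fin 3)), (a z * timeDeriv φ z.1 z.2 + G z * φ z.1 z.2) = 0)
    {η : ℝ → ℝ} (hη : ContDiff ℝ ∞ η) (hηc : HasCompactSupport η) (hηI : tsupport η ⊆ Ioo lo hi)
    {x : (EuclideanSpace ℝ (Fin 3))} (hx : x ∈ U) :
    ∫ t, (deriv η t * a (t, x) + η t * G (t, x)) = 0 := by
  -- the parametric integral `Λ` and its continuity on `U`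
  set H : ℝ × (EuclideanSpace ℝ (Fin 3)) → ℝ := fun z => deriv η z.1 * a z + η z.1 * G z with hH
  set Λ : (EuclideanSpace ℝ (Fin 3)) → ℝ := fun y => ∫ t, H (t, y) with hΛ
  have hηd : Continuous (deriv η) := hη.continuous_deriv (by simp)
  have hHc : ContinuousOn H (Ioo lo hi ×ˢ U) := by
    rw [← hQ]
    exact ((hηd.comp continuous_fst).continuousOn.mul ha).add
      ((hη.continuous.comp continuous_fst).continuousOn.mul hG)
  have hK : IsCompact (tsupport η) := hηc
  have hH0 : ∀ t, t ∉ tsupport η → ∀ y, H (t, y) = 0 := by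
    intro t ht y
    have h1 : η t = 0 := image_eq_zero_of_notMem_tsupport ht
    have h2 : deriv η t = 0 := by
      have : t ∉ tsupport (deriv η) := fun h' => ht (tsupport_deriv_subset h')
      exact image_eq_zero_of_notMem_tsupport this
    simp only [hH, h1, h2, zero_mul, add_zero]
  have hΛc : ContinuousOn Λ U := continuousOn_integral_slice isOpen_Ioo hU hHc hK hηI hH0
  -- `∫ χ Λ = 0` for every test function `χ` on `U`
  have hzero : ∀ χ : (EuclideanSpace ℝ (Fin 3)) → ℝ, ContDiff ℝ ∞ χ → HasCompactSupport χ → tsupport χ ⊆ U →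
      ∫ y, χ y • Λ y = 0 := by
    intro χ hχ hχc hχU
    have hφ := isSpaceTimeTestOn_mul hQ hη hηc hηI hχ hχc hχU
    have hφt : ∀ t y, timeDeriv (fun t x => η t * χ x) t y = deriv η t * χ y := by
      intro t y
      simp only [timeDeriv]
      exact deriv_mul_const (hη.differentiable (by simp) t) _
    have hint := h _ hφ
    simp only [hφt] at hint
    -- Fubini
    set F : ℝ × (EuclideanSpace ℝ (Fin 3)) → ℝ := fun z => a z * (deriv η z.1 * χ z.2) + G z * (η z.1 * χ z.2) with hF
    have hFi : Integrable F := by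
      have i1 := integrable_mul_timeDeriv ha hφ
      simp only [hφt] at i1
      exact i1.add (integrable_mul_test hG hφ)
    have hFub : ∫ z, F z = ∫ y, ∫ t, F (t, y) := by
      rw [Measure.volume_eq_prod]
      exact integral_prod_symm F ((Measure.volume_eq_prod (ℝ) ((EuclideanSpace ℝ (Fin 3)))) ▸ hFi)
    have hslice : ∀ y, ∫ t, F (t, y) = χ y • Λ y := by
      intro y
      simp only [hΛ, hH, smul_eq_mul, ← integral_const_mul]
      refine integral_congr_ae (Eventually.of_forall fun t => ?_)
      simp only [hF]
      ring
    calc ∫ y, χ y • Λ y = ∫ y, ∫ t, F (t, y) := by simp_rw [hslice]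
      _ = ∫ z, F z := hFub.symm
      _ = 0 := hint
  -- the fundamental lemma in `x` and continuity
  have hae : ∀ᵐ y ∂(volume : Measure (EuclideanSpace ℝ (Fin 3))), y ∈ U → Λ y = 0 :=
    hU.ae_eq_zero_of_integral_contDiff_smul_eq_zero (hΛc.locallyIntegrableOn hU.measurableSet) hzero
  have hae' : ∀ᵐ y ∂(volume.restrict U), Λ y = 0 := (ae_restrict_iff' hU.measurableSet).2 hae
  have h1 : ∀ y ∈ U, Λ y ≤ 0 :=
    forall_le_of_ae_le_of_continuousOn hU hΛc continuousOn_const (hae'.mono fun y hy => hy.le)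
  have h2 : ∀ y ∈ U, (0 : ℝ) ≤ Λ y :=
    forall_le_of_ae_le_of_continuousOn hU continuousOn_const hΛc (hae'.mono fun y hy => hy.ge)
  have hΛx : Λ x = 0 := le_antisymm (h1 x hx) (h2 x hx)
  simpa only [hΛ, hH] using hΛx

/-- **From the distributional identity to the time-integrated one, at every point.** Let `a`, `G`
be continuous on `Q = ]lo, hi[ × U` (`U ⊆ ℝ³` open) with `∫∫ (a ∂ₜφ + G φ) = 0` for all
space–time test functions `φ` on `Q` (i.e. `∂ₜa = G` in `𝒟'(Q)`). Then for every `x ∈ U` and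
`lo < s ≤ t < hi`, `a(t, x) - a(s, x) = ∫ₛᵗ G(r, x) dr`: slice the identity
(`integral_deriv_mul_add_mul_eq_zero_of_forall_test`), apply the du Bois-Reymond lemma with a
source term on a compact subinterval (`exists_ae_eq_const_add_primitive`: `a(·,x) = c + ∫ G(·,x)`
a.e.), and upgrade to every time by continuity (Brezis 2011, Lemma 8.1 / Cor. 8.10).
[folklore] -/
theorem sub_eq_intervalIntegral_of_forall_test (hU : IsOpen U)
    (hQ : (Q : Set (ℝ × (EuclideanSpace ℝ (Fin 3)))) = Ioo lo hi ×ˢ U) (ha : ContinuousOn a (Q : Set (ℝ × (EuclideanSpace ℝ (Fin 3)))))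
    (hG : ContinuousOn G (Q : Set (ℝ × (EuclideanSpace ℝ (Fin 3)))))
    (h : ∀ φ : ℝ → (EuclideanSpace ℝ (Fin 3)) → ℝ, IsSpaceTimeTestOn Q φ →
      ∫ z : ℝ × (EuclideanSpace ℝ (Fin 3)), (a z * timeDeriv φ z.1 z.2 + G z * φ z.1 z.2) = 0)
    {x : (EuclideanSpace ℝ (Fin 3))} (hx : x ∈ U) {s t : ℝ} (hs : lo < s) (hst : s ≤ t) (ht : t < hi) :
    a (t, x) - a (s, x) = ∫ r in s..t, G (r, x) := by
  -- a compact subinterval `[lo', hi'] ⊆ ]lo, hi[` containing `s`, `t` in its interior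
  set lo' : ℝ := (lo + s) / 2 with hlo'
  set hi' : ℝ := (t + hi) / 2 with hhi'
  have h1 : lo < lo' := by rw [hlo']; linarith
  have h2 : lo' < s := by rw [hlo']; linarith
  have h3 : t < hi' := by rw [hhi']; linarith
  have h4 : hi' < hi := by rw [hhi']; linarith
  have hsub : Icc lo' hi' ⊆ Ioo lo hi := fun r hr => ⟨lt_of_lt_of_le h1 hr.1, lt_of_le_of_lt hr.2 h4⟩
  -- the slices of `a` and `G` at `x`
  set g : ℝ → ℝ := fun r => a (r, x) with hg
  set f : ℝ → ℝ := fun r => G (r, x) with hf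
  have hmk : Continuous fun r : ℝ => ((r, x) : ℝ × (EuclideanSpace ℝ (Fin 3))) := continuous_id.prodMk continuous_const
  have hgc : ContinuousOn g (Icc lo' hi') := by
    refine ContinuousOn.comp (g := a) (f := fun r : ℝ => ((r, x) : ℝ × (EuclideanSpace ℝ (Fin 3)))) ha hmk.continuousOn ?_
    intro r hr
    rw [hQ]
    exact ⟨hsub hr, hx⟩
  have hfc : ContinuousOn f (Icc lo' hi') := by
    refine ContinuousOn.comp (g := G) (f := fun r : ℝ => ((r, x) : ℝ × (EuclideanSpace ℝ (Fin 3)))) hG hmk.continuousOn ?_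
    intro r hr
    rw [hQ]
    exact ⟨hsub hr, hx⟩
  have hgi : IntegrableOn g (Ioo lo' hi') := hgc.integrableOn_Icc.mono_set Ioo_subset_Icc_self
  have hfi : IntegrableOn f (Ioo lo' hi') := hfc.integrableOn_Icc.mono_set Ioo_subset_Icc_self
  -- the hypothesis of the du Bois-Reymond lemma on `]lo', hi'[`
  have hW : ∀ χ : ℝ → ℝ, ContDiff ℝ (⊤ : ℕ∞) χ → HasCompactSupport χ → tsupport χ ⊆ Ioo lo' hi' →
      ∫ r in Ioo lo' hi', (deriv χ r * g r + χ r * f r) = 0 := by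
    intro χ hχ hχc hχI
    have hχI' : tsupport χ ⊆ Ioo lo hi := hχI.trans (Ioo_subset_Ioo h1.le h4.le)
    have hall := integral_deriv_mul_add_mul_eq_zero_of_forall_test hU hQ ha hG h hχ hχc hχI' hx
    rw [setIntegral_eq_integral_of_forall_compl_eq_zero fun r hr => ?_]
    · exact hall
    · have hr' : r ∉ tsupport χ := fun h' => hr (hχI h')
      have e1 : χ r = 0 := image_eq_zero_of_notMem_tsupport hr'
      have e2 : deriv χ r = 0 :=
        image_eq_zero_of_notMem_tsupport fun h' => hr' (tsupport_deriv_subset h')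
      rw [e1, e2, zero_mul, zero_mul, add_zero]
  obtain ⟨c, hc⟩ := exists_ae_eq_const_add_primitive hgi hfi hW
  -- upgrade to every time of `]lo', hi'[` by continuity
  set Φ : ℝ → ℝ := fun r => c + ∫ u in Ioc lo' r, f u with hΦ
  have hfI : IntegrableOn f (Icc lo' hi') := hfc.integrableOn_Icc
  have hΦc : ContinuousOn Φ (Ioo lo' hi') := by
    have hprim : ContinuousOn (fun r => ∫ u in lo'..r, f u) (Icc lo' hi') := by
      have hii : IntervalIntegrable f volume lo' hi' := by
        refine (hfI.mono_set ?_).intervalIntegrable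
        rw [uIcc_of_le (by linarith : lo' ≤ hi')]
      have h' := intervalIntegral.continuousOn_primitive_interval' (μ := volume) (f := f)
        (a := lo') (b₁ := lo') (b₂ := hi') hii left_mem_uIcc
      rwa [uIcc_of_le (by linarith : lo' ≤ hi')] at h'
    have hsum : ContinuousOn (fun r => c + ∫ u in lo'..r, f u) (Ioo lo' hi') :=
      continuousOn_const.add (hprim.mono Ioo_subset_Icc_self)
    refine hsum.congr fun r hr => ?_
    simp only [hΦ, intervalIntegral.integral_of_le hr.1.le]
  have hgc' : ContinuousOn g (Ioo lo' hi') := hgc.mono Ioo_subset_Icc_self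
  have hle : ∀ r ∈ Ioo lo' hi', g r ≤ Φ r :=
    forall_le_of_ae_le_of_continuousOn isOpen_Ioo hgc' hΦc (hc.mono fun r hr => hr.le)
  have hge : ∀ r ∈ Ioo lo' hi', Φ r ≤ g r :=
    forall_le_of_ae_le_of_continuousOn isOpen_Ioo hΦc hgc' (hc.mono fun r hr => hr.ge)
  have heq : ∀ r ∈ Ioo lo' hi', g r = c + ∫ u in lo'..r, f u := by
    intro r hr
    rw [intervalIntegral.integral_of_le hr.1.le]
    exact le_antisymm (hle r hr) (hge r hr)
  -- evaluate at `t` and `s`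
  have hs' : s ∈ Ioo lo' hi' := ⟨h2, lt_of_le_of_lt hst h3⟩
  have ht' : t ∈ Ioo lo' hi' := ⟨lt_of_lt_of_le h2 hst, h3⟩
  have hit : IntervalIntegrable f volume lo' t := by
    refine (hfI.mono_set ?_).intervalIntegrable
    rw [uIcc_of_le ht'.1.le]
    exact Icc_subset_Icc le_rfl ht'.2.le
  have his : IntervalIntegrable f volume lo' s := by
    refine (hfI.mono_set ?_).intervalIntegrable
    rw [uIcc_of_le hs'.1.le]
    exact Icc_subset_Icc le_rfl hs'.2.le
  show g t - g s = ∫ u in s..t, f u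
  rw [heq t ht', heq s hs', add_sub_add_left_eq_sub, intervalIntegral.integral_interval_sub_left hit his]

end Localisation

/-! ### The swirl operator is continuous on `Q̃` -/

section Operator

variable {V : ℝ → (EuclideanSpace ℝ (Fin 3)) → (EuclideanSpace ℝ (Fin 3))} {P : ℝ → (EuclideanSpace ℝ (Fin 3)) → ℝ}

/-- The radial unit vector `e_r` is continuous off the axis (a private copy of the tree's
`continuousOn_eR`, `SereginZajaczkowski2007L42VorticityProofs`, not imported here). [folklore] -/
private theorem continuousOn_eR_offAxis :
    ContinuousOn eR {x : (EuclideanSpace ℝ (Fin 3)) | cylRadius x ≠ 0} := by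
  have hh : Continuous fun x : (EuclideanSpace ℝ (Fin 3)) => (toLp 2 ![x 0, x 1, 0] : (EuclideanSpace ℝ (Fin 3))) := by
    refine (PiLp.continuous_toLp 2 _).comp (continuous_pi fun i => ?_)
    have h0 : Continuous fun x : (EuclideanSpace ℝ (Fin 3)) => x 0 := PiLp.continuous_apply 2 _ 0
    have h1 : Continuous fun x : (EuclideanSpace ℝ (Fin 3)) => x 1 := PiLp.continuous_apply 2 _ 1
    fin_cases i
    · exact h0.congr fun x => by simp
    · exact h1.congr fun x => by simp
    · exact (continuous_const (y := (0 : ℝ))).congr fun x => by simp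
  exact (continuous_cylRadius.continuousOn.inv₀ fun x hx => hx).smul hh.continuousOn

/-- **The right-hand side `Δα - Dα[V] - (2/ϱ)∂_ϱα` is continuous on `Q̃`** for the class of
Prop. 4.1 (all spatial derivatives of `V` are continuous on `Q̃` in space–time; the local formulas
`Δα = ⟪Jx, ΔV⟫ + 2(∂₀V₁ - ∂₁V₀)`, `DΓ h = ⟪Jx, DV h⟫ + ⟪Jh, V⟫`; `ϱ > 1/4` on the shell).
[folklore] -/
theorem continuousOn_swirlOperator
    (hV : IsSmoothAxisymmetricSolutionOn (shellCylOpens (1 / 4) 3 2 2) V P) :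
    ContinuousOn (fun z : ℝ × (EuclideanSpace ℝ (Fin 3)) => (Δ (swirl (V z.1))) z.2 - fderiv ℝ (swirl (V z.1)) z.2 (V z.1 z.2) -
      2 / cylRadius z.2 * partialDeriv (eR z.2) (swirl (V z.1)) z.2)
      ((shellCylOpens (1 / 4) 3 2 2 : Opens (ℝ × (EuclideanSpace ℝ (Fin 3)))) : Set (ℝ × (EuclideanSpace ℝ (Fin 3)))) := by
  have hJ : Continuous fun z : ℝ × (EuclideanSpace ℝ (Fin 3)) => rotGen z.2 := rotGenL.continuous.comp continuous_snd
  -- (i) the Laplacian of the swirl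
  have hL : ContinuousOn (fun z : ℝ × (EuclideanSpace ℝ (Fin 3)) => (Δ (swirl (V z.1))) z.2)
      ((shellCylOpens (1 / 4) 3 2 2 : Opens (ℝ × (EuclideanSpace ℝ (Fin 3)))) : Set (ℝ × (EuclideanSpace ℝ (Fin 3)))) := by
    have hΔV : ContinuousOn (fun z : ℝ × (EuclideanSpace ℝ (Fin 3)) => (Δ (V z.1)) z.2)
        ((shellCylOpens (1 / 4) 3 2 2 : Opens (ℝ × (EuclideanSpace ℝ (Fin 3)))) : Set (ℝ × (EuclideanSpace ℝ (Fin 3)))) := by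
      have e : (fun z : ℝ × (EuclideanSpace ℝ (Fin 3)) => (Δ (V z.1)) z.2) = fun z => ∑ j, iteratedFDeriv ℝ 2 (V z.1) z.2
          ![EuclideanSpace.basisFun (Fin 3) ℝ j, EuclideanSpace.basisFun (Fin 3) ℝ j] := by
        funext z
        exact congrFun (InnerProductSpace.laplacian_eq_iteratedFDeriv_orthonormalBasis (V z.1)
          (EuclideanSpace.basisFun (Fin 3) ℝ)) z.2
      rw [e]
      exact continuousOn_finsetSum _ fun j _ =>
        (continuous_eval_const _).comp_continuousOn (hV.continuousOn_iteratedFDeriv 2)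
    have hω : ContinuousOn (fun z : ℝ × (EuclideanSpace ℝ (Fin 3)) => fderiv ℝ (V z.1) z.2 (EuclideanSpace.single 0 1) 1 -
        fderiv ℝ (V z.1) z.2 (EuclideanSpace.single 1 1) 0)
        ((shellCylOpens (1 / 4) 3 2 2 : Opens (ℝ × (EuclideanSpace ℝ (Fin 3)))) : Set (ℝ × (EuclideanSpace ℝ (Fin 3)))) :=
      ((EuclideanSpace.proj (1 : Fin 3)).continuous.comp_continuousOn
        (hV.continuousOn_fderiv.clm_apply continuousOn_const)).sub
        ((EuclideanSpace.proj (0 : Fin 3)).continuous.comp_continuousOn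
          (hV.continuousOn_fderiv.clm_apply continuousOn_const))
    have hc : ContinuousOn (fun z : ℝ × (EuclideanSpace ℝ (Fin 3)) => ⟪rotGen z.2, (Δ (V z.1)) z.2⟫ +
        2 * (fderiv ℝ (V z.1) z.2 (EuclideanSpace.single 0 1) 1 -
          fderiv ℝ (V z.1) z.2 (EuclideanSpace.single 1 1) 0))
        ((shellCylOpens (1 / 4) 3 2 2 : Opens (ℝ × (EuclideanSpace ℝ (Fin 3)))) : Set (ℝ × (EuclideanSpace ℝ (Fin 3)))) :=
      (hJ.continuousOn.inner hΔV).add (continuousOn_const.mul hω)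
    exact hc.congr fun z hz => laplacian_swirl_of_contDiffAt (hV.contDiffAt z hz)
  -- (ii) the convective derivative of the swirl
  have hC : ContinuousOn (fun z : ℝ × (EuclideanSpace ℝ (Fin 3)) => fderiv ℝ (swirl (V z.1)) z.2 (V z.1 z.2))
      ((shellCylOpens (1 / 4) 3 2 2 : Opens (ℝ × (EuclideanSpace ℝ (Fin 3)))) : Set (ℝ × (EuclideanSpace ℝ (Fin 3)))) := by
    have hc : ContinuousOn (fun z : ℝ × (EuclideanSpace ℝ (Fin 3)) => ⟪rotGen z.2, fderiv ℝ (V z.1) z.2 (V z.1 z.2)⟫ +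
        ⟪rotGen (V z.1 z.2), V z.1 z.2⟫)
        ((shellCylOpens (1 / 4) 3 2 2 : Opens (ℝ × (EuclideanSpace ℝ (Fin 3)))) : Set (ℝ × (EuclideanSpace ℝ (Fin 3)))) :=
      (hJ.continuousOn.inner (hV.continuousOn_fderiv.clm_apply hV.continuousOn_velocity)).add
        ((rotGenL.continuous.comp_continuousOn hV.continuousOn_velocity).inner hV.continuousOn_velocity)
    exact hc.congr fun z hz => fderiv_swirl_apply (hV.differentiableAt hz) _
  -- (iii) the radial derivative of the swirl
  have hR : ContinuousOn (fun z : ℝ × (EuclideanSpace ℝ (Fin 3)) => 2 / cylRadius z.2 * partialDeriv (eR z.2) (swirl (V z.1)) z.2)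
      ((shellCylOpens (1 / 4) 3 2 2 : Opens (ℝ × (EuclideanSpace ℝ (Fin 3)))) : Set (ℝ × (EuclideanSpace ℝ (Fin 3)))) := by
    have hρ : ∀ z ∈ ((shellCylOpens (1 / 4) 3 2 2 : Opens (ℝ × (EuclideanSpace ℝ (Fin 3)))) : Set (ℝ × (EuclideanSpace ℝ (Fin 3)))),
        cylRadius z.2 ≠ 0 := fun z hz => cylRadius_ne_zero_of_mem_shell (by norm_num) hz.2
    have heR : ContinuousOn (fun z : ℝ × (EuclideanSpace ℝ (Fin 3)) => eR z.2)
        ((shellCylOpens (1 / 4) 3 2 2 : Opens (ℝ × (EuclideanSpace ℝ (Fin 3)))) : Set (ℝ × (EuclideanSpace ℝ (Fin 3)))) :=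
      continuousOn_eR_offAxis.comp continuous_snd.continuousOn fun z hz => hρ z hz
    have h2 : ContinuousOn (fun z : ℝ × (EuclideanSpace ℝ (Fin 3)) => 2 / cylRadius z.2)
        ((shellCylOpens (1 / 4) 3 2 2 : Opens (ℝ × (EuclideanSpace ℝ (Fin 3)))) : Set (ℝ × (EuclideanSpace ℝ (Fin 3)))) :=
      continuousOn_const.div (continuous_cylRadius.comp continuous_snd).continuousOn hρ
    have hc : ContinuousOn (fun z : ℝ × (EuclideanSpace ℝ (Fin 3)) => 2 / cylRadius z.2 *
        (⟪rotGen z.2, fderiv ℝ (V z.1) z.2 (eR z.2)⟫ + ⟪rotGen (eR z.2), V z.1 z.2⟫))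
        ((shellCylOpens (1 / 4) 3 2 2 : Opens (ℝ × (EuclideanSpace ℝ (Fin 3)))) : Set (ℝ × (EuclideanSpace ℝ (Fin 3)))) :=
      h2.mul ((hJ.continuousOn.inner (hV.continuousOn_fderiv.clm_apply heR)).add
        ((rotGenL.continuous.comp_continuousOn heR).inner hV.continuousOn_velocity))
    refine hc.congr fun z hz => ?_
    simp only [partialDeriv_apply, fderiv_swirl_apply (hV.differentiableAt hz)]
  exact (hL.sub hC).sub hR

end Operator

/-! ### The discharge -/

/-- **Discharge of `SereginZajaczkowski2007.SwirlEquation`** (Seregin–Zajaczkowski 2007, proof of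
Lemma 4.3, (4.15): "We know that `V_φ` satisfies the equation
`∂_t V_φ + V_ϱ V_{φ,ϱ} + V₃ V_{φ,3} + (1/ϱ) V_ϱ V_φ - (V_{φ,ϱϱ} + V_{φ,33} + (1/ϱ) V_{φ,ϱ} - (1/ϱ²) V_φ) = 0`",
in the `α = ϱV_φ` form `∂ₜα + V·∇α - Δα + (2/ϱ)∂_ϱα = 0`, integrated in time at each point of the
shell). For the hypothesis class of Prop. 4.1 on `Q̃`: the swirl equation holds in `𝒟'(Q̃)`
(`integral_swirl_mul_timeDeriv_add_eq_zero`: momentum equation tested with `φ J`, pressure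
removed by rotation averaging, `x`-derivatives transferred onto the smooth-in-`x` velocity), its
right-hand side is continuous on `Q̃` (`continuousOn_swirlOperator`), and a distributional
identity `∂ₜa = G` with continuous `a`, `G` on `]lo, hi[ × U` integrates to
`a(t,x) - a(s,x) = ∫ₛᵗ G(r,x) dr` at every point (`sub_eq_intervalIntegral_of_forall_test`).
[cite: SereginZajaczkowski2007, §4 proof of Lemma 4.3, (4.15) and "α = V_φ ϱ"] -/
theorem SwirlEquation_holds : SwirlEquation := by
  intro V P hV x hx s t hs hst ht
  have hQ : ((shellCylOpens (1 / 4) 3 2 2 : Opens (ℝ × (EuclideanSpace ℝ (Fin 3)))) : Set (ℝ × (EuclideanSpace ℝ (Fin 3)))) =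
      Ioo (-2 ^ 2) 0 ×ˢ shell (1 / 4) 3 2 := rfl
  exact sub_eq_intervalIntegral_of_forall_test (Q := shellCylOpens (1 / 4) 3 2 2)
    (a := fun z : ℝ × (EuclideanSpace ℝ (Fin 3)) => swirl (V z.1) z.2)
    (G := fun z : ℝ × (EuclideanSpace ℝ (Fin 3)) => (Δ (swirl (V z.1))) z.2 - fderiv ℝ (swirl (V z.1)) z.2 (V z.1 z.2) -
      2 / cylRadius z.2 * partialDeriv (eR z.2) (swirl (V z.1)) z.2)
    (isOpen_shell _ _ _) hQ hV.continuousOn_swirl (continuousOn_swirlOperator hV)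
    (fun φ hφ => integral_swirl_mul_timeDeriv_add_eq_zero hV hφ) hx hs hst ht

end SereginZajaczkowski2007

end Literature.Analysis.FluidPDE
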